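import Literature.NumberTheory.LFunctions.LiouvilleTwoPowerModuli
import Literature.NumberTheory.LFunctions.LiouvilleSumClassicalBound
import Literature.NumberTheory.LFunctions.MoebiusWalshFourierProofs
import Mathlib.NumberTheory.DirichletCharacter.Orthogonality
import HarnessLib

/-!
# `DigitPolyUniformity` (stmt-QuantumAdvantage-1392), line `Sketch` — stub `stub_ends`
# (equidistribution of `λ` on the atoms of the two-ends σ-algebra at growing depth)

For every `ε > 0`, eventually in `n`: for all depths `k, m` with `(k + m)^3 ≤ n` and every
`1`-bounded `g : ℕ → ℕ → ℝ`,
`|Σ_{N < 2^n} λ(N) g(N mod 2^k, ⌊N / 2^{n−m}⌋)| ≤ ε 2^n`.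

## Proof

* Regroup `Σ_{N<2^n}` by the `2^{k+m}` atoms `{N < 2^n : N ≡ a (2^k), ⌊N/2^{n−m}⌋ = j}`,
  `a < 2^k`, `j < 2^m`, on which `g` is constant of modulus `≤ 1`
  (`abs_sum_mul_ends_le`): `|Σ λ g| ≤ Σ_a Σ_j |Σ_{atom(a,j)} λ|`.
* Each atom is a progression mod `2^k` inside the interval `[j 2^{n−m}, (j+1) 2^{n−m})`, so its
  `λ`-sum is the difference of two initial progression sums `Σ_{N < X, N ≡ a (2^k)} λ(N)` with
  `X ≤ 2^n` (`sum_atom_eq`).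
* THE INPUT: the tree's PROVED prime number theorem for `λ` twisted by Dirichlet characters to
  `2`-power moduli (Green 2012, Theorem 3 with the §1 remark on `λ` = Montgomery–Vaughan §11.3.1
  Exercise 6 for `q = 2^t`, where no exceptional zero occurs):
  `Literature.NumberTheory.LFunctions.green_liouville_character_twoPower_holds`, made uniform
  in `X ≤ 2^n`, `t ≤ k` by the tree's `GreenWalsh.char_bound_uniform` and turned into a bound for
  every progression sum to modulus `2^k` (odd classes by orthogonality of characters, even classes
  by `λ(2N') = −λ(N')`, induction on `k`) by the tree's `GreenWalsh.norm_sum_progression_le`: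
  every `|Σ_{N < X, N ≡ a (2^k)} λ(N)|`, `X ≤ 2^n`, is at most `K 2^n e^{−(c/2)√(n log 2)}` as
  soon as `n log 2 ≥ max(1, c²)` and `2^k ≤ e^{(c/8)√(n log 2)}`.
* Numerics (`eventually_linear_le_sqrt`): `k + m ≤ n^{1/3} = o(√n)`, so eventually
  `2^k ≤ e^{(c/8)√(n log 2)}` and `2^{k+m+1} K e^{−(c/2)√(n log 2)} ≤ ε`.

No `Summits.*` import: the statement mentions only Mathlib's `ArithmeticFunction.liouville`.
-/

noncomputable section

namespace Summit.QuantumAdvantage.DigitPolyUniformity.Sketch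

open Filter Finset ArithmeticFunction
open Literature.NumberTheory.LFunctions

namespace StubEnds

/-! ### Regrouping by the atoms of the two-ends σ-algebra -/

/-- **Regrouping by atoms.** For `m ≤ n`, a `1`-bounded `g` and any `f`,
`|Σ_{N<2^n} f(N) g(N mod 2^k, ⌊N/2^{n−m}⌋)| ≤ Σ_{a<2^k} Σ_{j<2^m} |Σ_{atom(a,j)} f|`, where
`atom(a,j) = {N < 2^n : N mod 2^k = a, ⌊N/2^{n−m}⌋ = j}` (`g` is constant on atoms). [folklore] -/
theorem abs_sum_mul_ends_le (n k m : ℕ) (hm : m ≤ n) (f : ℕ → ℝ) (g : ℕ → ℕ → ℝ)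
    (hg : ∀ a j, |g a j| ≤ 1) :
    |∑ N ∈ range (2 ^ n), f N * g (N % 2 ^ k) (N / 2 ^ (n - m))| ≤
      ∑ a ∈ range (2 ^ k), ∑ j ∈ range (2 ^ m),
        |∑ N ∈ (range (2 ^ n)).filter (fun N => (N % 2 ^ k, N / 2 ^ (n - m)) = (a, j)), f N| := by
  have hmaps : ∀ N ∈ range (2 ^ n),
      (fun N : ℕ => (N % 2 ^ k, N / 2 ^ (n - m))) N ∈ range (2 ^ k) ×ˢ range (2 ^ m) := by
    intro N hN
    rw [mem_range] at hN
    rw [Finset.mem_product, mem_range, mem_range]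
    refine ⟨Nat.mod_lt _ (by positivity), ?_⟩
    rw [Nat.div_lt_iff_lt_mul (by positivity), ← pow_add, Nat.add_sub_cancel' hm]
    exact hN
  have hfib := sum_fiberwise_of_maps_to hmaps (fun N => f N * g (N % 2 ^ k) (N / 2 ^ (n - m)))
  rw [← hfib, sum_product]
  refine (abs_sum_le_sum_abs _ _).trans (sum_le_sum fun a _ => ?_)
  refine (abs_sum_le_sum_abs _ _).trans (sum_le_sum fun j _ => ?_)
  have h : ∑ N ∈ (range (2 ^ n)).filter (fun N => (N % 2 ^ k, N / 2 ^ (n - m)) = (a, j)),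
        f N * g (N % 2 ^ k) (N / 2 ^ (n - m)) =
      g a j * ∑ N ∈ (range (2 ^ n)).filter (fun N => (N % 2 ^ k, N / 2 ^ (n - m)) = (a, j)),
        f N := by
    rw [mul_sum]
    refine sum_congr rfl fun N hN => ?_
    obtain ⟨-, hN⟩ := mem_filter.1 hN
    simp only [Prod.mk.injEq] at hN
    rw [hN.1, hN.2]
    ring
  rw [h, abs_mul]
  exact mul_le_of_le_one_left (abs_nonneg _) (hg a j)

/-- Membership in an atom's interval: for `L > 0` and `j L + L ≤ T`,
`N < T ∧ ⌊N/L⌋ = j ↔ j L ≤ N < j L + L`. [folklore] -/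
theorem lt_and_div_eq_iff {L j T N : ℕ} (hL : 0 < L) (hT : j * L + L ≤ T) :
    (N < T ∧ N / L = j) ↔ (j * L ≤ N ∧ N < j * L + L) := by
  rw [Nat.div_eq_iff hL]
  generalize j * L = M at hT ⊢
  omega

/-- **An atom is a difference of two initial progressions.** For `m ≤ n` and `j < 2^m`,
`Σ_{N<2^n, N mod 2^k = a, ⌊N/2^{n−m}⌋ = j} f(N) = P((j+1) 2^{n−m}) − P(j 2^{n−m})` with
`P(X) = Σ_{N < X, N mod 2^k = a} f(N)`. [folklore] -/
theorem sum_atom_eq (n k m a j : ℕ) (hm : m ≤ n) (hj : j < 2 ^ m) (f : ℕ → ℝ) :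
    ∑ N ∈ (range (2 ^ n)).filter (fun N => (N % 2 ^ k, N / 2 ^ (n - m)) = (a, j)), f N =
      ∑ N ∈ (range ((j + 1) * 2 ^ (n - m))).filter (fun N => N % 2 ^ k = a), f N -
        ∑ N ∈ (range (j * 2 ^ (n - m))).filter (fun N => N % 2 ^ k = a), f N := by
  set L : ℕ := 2 ^ (n - m) with hL
  have hL0 : 0 < L := by positivity
  have hLn : 2 ^ m * L = 2 ^ n := by rw [hL, ← pow_add, Nat.add_sub_cancel' hm]
  have hjL : (j + 1) * L = j * L + L := by ring
  have hjn : j * L + L ≤ 2 ^ n := by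
    calc j * L + L = (j + 1) * L := hjL.symm
      _ ≤ 2 ^ m * L := Nat.mul_le_mul_right _ hj
      _ = 2 ^ n := hLn
  have hset : (range (2 ^ n)).filter (fun N => (N % 2 ^ k, N / L) = (a, j)) =
      (Ico (j * L) (j * L + L)).filter (fun N => N % 2 ^ k = a) := by
    ext N
    simp only [mem_filter, mem_range, mem_Ico, Prod.mk.injEq]
    constructor
    · rintro ⟨hN, hNa, hNj⟩
      exact ⟨(lt_and_div_eq_iff hL0 hjn).1 ⟨hN, hNj⟩, hNa⟩
    · rintro ⟨hNI, hNa⟩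
      obtain ⟨hN, hNj⟩ := (lt_and_div_eq_iff hL0 hjn).2 hNI
      exact ⟨hN, hNa, hNj⟩
  rw [hset, sum_filter, sum_filter, sum_filter, hjL, sum_Ico_eq_sub _ (Nat.le_add_right _ _)]

/-! ### Progression sums of `λ`: from the complex form of the tree to the real form used here -/

/-- `|Σ_{N<X, N mod 2^k = a} λ(N)| = ‖Σ_{N<X, N ≡ a in ZMod 2^k} λ(N)‖` for `a < 2^k` (real versus
complex casts, `ℕ`-residue versus `ZMod` residue). [folklore] -/
theorem abs_sum_filter_mod_eq_norm (k a X : ℕ) (ha : a < 2 ^ k) :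
    |∑ N ∈ (range X).filter (fun N => N % 2 ^ k = a), (liouville N : ℝ)| =
      ‖∑ N ∈ (range X).filter (fun N : ℕ => (N : ZMod (2 ^ k)) = ((a : ℕ) : ZMod (2 ^ k))),
        ((liouville N : ℤ) : ℂ)‖ := by
  have hfilter : (range X).filter (fun N => N % 2 ^ k = a) =
      (range X).filter (fun N : ℕ => (N : ZMod (2 ^ k)) = ((a : ℕ) : ZMod (2 ^ k))) := by
    refine filter_congr fun N _ => ?_
    rw [ZMod.natCast_eq_natCast_iff', Nat.mod_eq_of_lt ha]
  rw [← hfilter, ← Real.norm_eq_abs, ← Complex.norm_real, Complex.ofReal_sum]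
  simp_rw [Complex.ofReal_intCast]

/-! ### Numerics: `k + m ≤ n^{1/3} = o(√n)` -/

/-- For `A, D > 0`, `C ≥ 0`: eventually in `n`, `A s + C ≤ D √n` for every `s` with `s^3 ≤ n`
(explicit threshold `n ≥ s₁^3`, `s₁ = ⌈(A+C)^2/D^2⌉ + 1`, through `(A s + C)^2 ≤ D^2 s^3 ≤ D^2 n`
for `s ≥ s₁`). [folklore] -/
theorem eventually_linear_le_sqrt {A C D : ℝ} (hA : 0 < A) (hC : 0 ≤ C) (hD : 0 < D) :
    ∀ᶠ n : ℕ in atTop, ∀ s : ℕ, s ^ 3 ≤ n → A * s + C ≤ D * Real.sqrt n := by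
  set s₁ : ℕ := ⌈(A + C) ^ 2 / D ^ 2⌉₊ + 1 with hs₁
  have hD2 : 0 < D ^ 2 := by positivity
  have key : ∀ s : ℕ, s₁ ≤ s → (A * s + C) ^ 2 ≤ D ^ 2 * (s : ℝ) ^ 3 := by
    intro s hs
    have hs1 : (1 : ℝ) ≤ s := by exact_mod_cast (Nat.le_add_left 1 _).trans hs
    have hsq : (A + C) ^ 2 / D ^ 2 ≤ s := Nat.ceil_le.1 ((Nat.le_succ _).trans hs)
    rw [div_le_iff₀ hD2] at hsq
    have h1 : A * s + C ≤ (A + C) * s := by nlinarith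
    have h0 : 0 ≤ A * s + C := by positivity
    calc (A * s + C) ^ 2 ≤ ((A + C) * s) ^ 2 := pow_le_pow_left₀ h0 h1 2
      _ = (A + C) ^ 2 * (s : ℝ) ^ 2 := by ring
      _ ≤ (D ^ 2 * s) * (s : ℝ) ^ 2 := by gcongr; linarith
      _ = D ^ 2 * (s : ℝ) ^ 3 := by ring
  refine (Filter.eventually_ge_atTop (s₁ ^ 3)).mono fun n hn s hs => ?_
  have hs'n : (max s s₁) ^ 3 ≤ n := by
    rcases le_total s s₁ with h | h
    · rw [max_eq_right h]; exact hn
    · rw [max_eq_left h]; exact hs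
  have hss' : (s : ℝ) ≤ (max s s₁ : ℕ) := by exact_mod_cast le_max_left s s₁
  have h2 := key (max s s₁) (le_max_right _ _)
  have h3 : D ^ 2 * ((max s s₁ : ℕ) : ℝ) ^ 3 ≤ D ^ 2 * n := by
    gcongr
    exact_mod_cast hs'n
  calc A * s + C ≤ A * ((max s s₁ : ℕ) : ℝ) + C := by gcongr
    _ ≤ Real.sqrt (D ^ 2 * n) := Real.le_sqrt_of_sq_le (h2.trans h3)
    _ = D * Real.sqrt n := by rw [Real.sqrt_mul hD2.le, Real.sqrt_sq hD.le]

end StubEnds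

open StubEnds

/-- **Stub `stub_ends` (ends equidistribution of `λ` at growing depth).** For every `ε > 0`,
eventually in `n`: for all depths `k, m` with `(k + m)^3 ≤ n` and every `1`-bounded `g`,
`|Σ_{N<2^n} λ(N) g(N mod 2^k, ⌊N/2^{n−m}⌋)| ≤ ε 2^n`. The `2^{k+m}` atoms
"progression mod `2^k` ∩ interval of length `2^{n−m}`" each carry a `λ`-sum
`≤ 2 K 2^n e^{−(c/2)√(n log 2)}` by the prime number theorem for `λ` twisted by characters to
`2`-power moduli (Green 2012, Theorem 3, with the §1 remark on the Liouville function;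
Montgomery–Vaughan §11.3.1 Exercise 6 for `q = 2^t`), PROVED in the tree as
`green_liouville_character_twoPower_holds` and transported to progressions by
`GreenWalsh.char_bound_uniform` / `GreenWalsh.norm_sum_progression_le`; and
`2^{k+m+1} K e^{−(c/2)√(n log 2)} ≤ ε` eventually because `k + m ≤ n^{1/3}`.
[cite: Green2012, Theorem 3 and §1 (remark on the Liouville function)] -/
theorem stub_ends :
    ∀ ε : ℝ, 0 < ε → ∀ᶠ n : ℕ in atTop, ∀ k m : ℕ, (k + m) ^ 3 ≤ n →
      ∀ g : ℕ → ℕ → ℝ, (∀ a j, |g a j| ≤ 1) →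
        |∑ N ∈ range (2 ^ n),
            (ArithmeticFunction.liouville N : ℝ) * g (N % 2 ^ k) (N / 2 ^ (n - m))| ≤
          ε * 2 ^ n := by
  intro ε hε
  have hgreen := green_liouville_character_twoPower_holds
  obtain ⟨c, hc, K, hK⟩ := hgreen
  -- enlarge the constant to `K' ≥ 1`
  set K' : ℝ := max K 1 with hK'def
  have hK'1 : 1 ≤ K' := le_max_right _ _
  have hK'0 : 0 < K' := lt_of_lt_of_le one_pos hK'1
  have hK' : ∀ t N : ℕ, ∀ χ : DirichletCharacter ℂ (2 ^ t),
      ((2 : ℝ) ^ t ≤ Real.exp (c * Real.sqrt (Real.log N))) →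
        ‖∑ x ∈ range N, ((liouville x : ℤ) : ℂ) * χ (x : ZMod (2 ^ t))‖
          ≤ K' * (N : ℝ) * Real.exp (-(c * Real.sqrt (Real.log N))) := by
    intro t N χ h
    refine (hK t N χ h).trans ?_
    gcongr
    exact le_max_left _ _
  have hlog2 : 0 < Real.log 2 := Real.log_pos one_lt_two
  have hsl2 : 0 < Real.sqrt (Real.log 2) := Real.sqrt_pos.2 hlog2
  -- the three eventualities
  have E1 : ∀ᶠ n : ℕ in atTop, max 1 (c ^ 2) ≤ Real.log ((2 : ℝ) ^ n) := by
    refine (Filter.eventually_ge_atTop ⌈max 1 (c ^ 2) / Real.log 2⌉₊).mono fun n hn => ?_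
    rw [Real.log_pow]
    have h := Nat.ceil_le.1 hn
    rw [div_le_iff₀ hlog2] at h
    linarith
  have E2 := eventually_linear_le_sqrt hlog2 le_rfl
    (mul_pos (div_pos hc (by norm_num : (0 : ℝ) < 8)) hsl2)
  have E3 := eventually_linear_le_sqrt hlog2
    (le_max_left 0 (Real.log 2 + Real.log K' - Real.log ε))
    (mul_pos (div_pos hc (by norm_num : (0 : ℝ) < 2)) hsl2)
  filter_upwards [E1, E2, E3] with n h1 h2 h3 k m hkm g hg
  -- bookkeeping
  have hs : k + m ≤ n := le_trans (Nat.le_self_pow three_ne_zero _) hkm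
  have hm : m ≤ n := le_trans (Nat.le_add_left m k) hs
  have hcast : ((2 ^ n : ℕ) : ℝ) = (2 : ℝ) ^ n := by push_cast; ring
  have hsqrt : Real.sqrt (Real.log ((2 : ℝ) ^ n)) = Real.sqrt n * Real.sqrt (Real.log 2) := by
    rw [Real.log_pow, Real.sqrt_mul (Nat.cast_nonneg n)]
  have h2' := h2 (k + m) hkm
  have h3' := h3 (k + m) hkm
  have hmax : Real.log 2 + Real.log K' - Real.log ε ≤
      max 0 (Real.log 2 + Real.log K' - Real.log ε) := le_max_right _ _
  push_cast at h2' h3'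
  -- the hypotheses of the uniform character-sum bound at `N = 2^n`, `t₀ = k`
  have hL : max 1 (c ^ 2) ≤ Real.log ((2 ^ n : ℕ) : ℝ) := by rw [hcast]; exact h1
  have hk2 : (2 : ℝ) ^ k ≤ Real.exp (c / 8 * Real.sqrt (Real.log ((2 ^ n : ℕ) : ℝ))) := by
    rw [hcast, hsqrt]
    have hk : (k : ℝ) ≤ k + m := by
      have : (0 : ℝ) ≤ m := Nat.cast_nonneg m
      linarith
    have hk' : Real.log 2 * k ≤ Real.log 2 * (k + m) := mul_le_mul_of_nonneg_left hk hlog2.le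
    calc (2 : ℝ) ^ k = Real.exp (Real.log ((2 : ℝ) ^ k)) := (Real.exp_log (by positivity)).symm
      _ = Real.exp (k * Real.log 2) := by rw [Real.log_pow]
      _ ≤ Real.exp (c / 8 * (Real.sqrt n * Real.sqrt (Real.log 2))) := by
          refine Real.exp_le_exp.2 ?_
          nlinarith [hk', h2']
  have hchar := GreenWalsh.char_bound_uniform hc hK'1 hK' (N := 2 ^ n) (t₀ := k) hL hk2
  have hprog := GreenWalsh.norm_sum_progression_le hchar k le_rfl
  -- the progression sums in real form
  have hP : ∀ X : ℕ, X ≤ 2 ^ n → ∀ a : ℕ, a < 2 ^ k →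
      |∑ N ∈ (range X).filter (fun N => N % 2 ^ k = a), (liouville N : ℝ)| ≤
        K' * ((2 ^ n : ℕ) : ℝ) *
          Real.exp (-(c / 2 * Real.sqrt (Real.log ((2 ^ n : ℕ) : ℝ)))) := by
    intro X hX a ha
    rw [abs_sum_filter_mod_eq_norm k a X ha]
    exact hprog X hX _
  -- the atoms
  have hatom : ∀ a : ℕ, a < 2 ^ k → ∀ j : ℕ, j < 2 ^ m →
      |∑ N ∈ (range (2 ^ n)).filter (fun N => (N % 2 ^ k, N / 2 ^ (n - m)) = (a, j)),
          (liouville N : ℝ)| ≤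
        2 * (K' * ((2 ^ n : ℕ) : ℝ) *
          Real.exp (-(c / 2 * Real.sqrt (Real.log ((2 ^ n : ℕ) : ℝ))))) := by
    intro a ha j hj
    have hLn : 2 ^ m * 2 ^ (n - m) = 2 ^ n := by rw [← pow_add, Nat.add_sub_cancel' hm]
    have hX1 : (j + 1) * 2 ^ (n - m) ≤ 2 ^ n := by
      calc (j + 1) * 2 ^ (n - m) ≤ 2 ^ m * 2 ^ (n - m) := Nat.mul_le_mul_right _ hj
        _ = 2 ^ n := hLn
    have hX0 : j * 2 ^ (n - m) ≤ 2 ^ n :=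
      le_trans (Nat.mul_le_mul_right _ (Nat.le_succ j)) hX1
    rw [sum_atom_eq n k m a j hm hj]
    refine (abs_sub _ _).trans ?_
    have hA := hP _ hX1 a ha
    have hB := hP _ hX0 a ha
    linarith
  -- assembly
  have hE : (2 : ℝ) ^ k * (2 : ℝ) ^ m * 2 * K' *
      Real.exp (-(c / 2 * Real.sqrt (Real.log ((2 : ℝ) ^ n)))) ≤ ε := by
    rw [hsqrt]
    have hpow : (2 : ℝ) ^ k * (2 : ℝ) ^ m * 2 = Real.exp (((k + m + 1 : ℕ) : ℝ) * Real.log 2) := by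
      rw [← Real.log_pow, Real.exp_log (by positivity)]
      ring
    rw [hpow, ← Real.exp_log hK'0, ← Real.exp_add, ← Real.exp_add]
    calc _ ≤ Real.exp (Real.log ε) := by
          refine Real.exp_le_exp.2 ?_
          push_cast
          nlinarith [h3', hmax]
      _ = ε := Real.exp_log hε
  calc |∑ N ∈ range (2 ^ n), (liouville N : ℝ) * g (N % 2 ^ k) (N / 2 ^ (n - m))|
      ≤ ∑ a ∈ range (2 ^ k), ∑ j ∈ range (2 ^ m),
          |∑ N ∈ (range (2 ^ n)).filter (fun N => (N % 2 ^ k, N / 2 ^ (n - m)) = (a, j)),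
            (liouville N : ℝ)| := abs_sum_mul_ends_le n k m hm _ g hg
    _ ≤ ∑ a ∈ range (2 ^ k), ∑ j ∈ range (2 ^ m),
          2 * (K' * ((2 ^ n : ℕ) : ℝ) *
            Real.exp (-(c / 2 * Real.sqrt (Real.log ((2 ^ n : ℕ) : ℝ))))) :=
        sum_le_sum fun a ha => sum_le_sum fun j hj => hatom a (mem_range.1 ha) j (mem_range.1 hj)
    _ = ((2 : ℝ) ^ k * (2 : ℝ) ^ m * 2 * K' *
          Real.exp (-(c / 2 * Real.sqrt (Real.log ((2 : ℝ) ^ n))))) * (2 : ℝ) ^ n := by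
        rw [sum_const, sum_const, card_range, card_range, nsmul_eq_mul, nsmul_eq_mul]
        push_cast
        ring
    _ ≤ ε * (2 : ℝ) ^ n := mul_le_mul_of_nonneg_right hE (by positivity)

end Summit.QuantumAdvantage.DigitPolyUniformity.Sketch

end
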